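import Mathlib.Algebra.Ring.Action.ConjAct
import Mathlib.Analysis.Normed.Field.Basic
import Mathlib.Analysis.SpecificLimits.Normed
import Mathlib.LinearAlgebra.Matrix.Charpoly.Coeff
import Mathlib.Topology.Instances.Matrix
import Literature.NumberTheory.GaloisRepresentations.WeilDeligneOfGaloisProofs
import Literature.NumberTheory.GaloisRepresentations.AbsGaloisGroupCompact
import Literature.NumberTheory.GaloisRepresentations.WeilDeligneDominance
import HarnessLib

/-!
# Barrier (Langlands): the monodromy operator is not closed under `p`-adic limits

Barrier catalogue entry (D-0021) for the summit `Langlands`, clause `LocalGlobalCompatibleAt`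
(Taylor's Conj. 7, `ι WD(ρ|_{Γ_{F_v}})^{F-ss} ≅ rec_v(π_v)` INCLUDING the monodromy operator `N`)
for Galois representations that are only known as `p`-ADIC LIMITS — `r_{π,ı}` for regular
algebraic, non-polarizable `π` over a CM field, "constructed by approximating it … by Galois
representations associated to conjugate self-dual automorphic representations"
(Harris–Lan–Taylor–Thorne, Scholze; quoted from A'Campo–Hevesi–Thorne–Whitmore, §1).  The
printed state of the art for such `r` is equality UP TO SEMISIMPLIFICATION together with the
one-sided relation `WD(r|_{Γ_{F_v}})^{F-ss} ≺ rec(π_v)` ("the monodromy … is 'more nilpotent' than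
the monodromy of `rec(π_v)`": Varma, `v ∤ p`; A'Campo–Hevesi–Thorne–Whitmore Thm. 1.2.1 and
Cor. 1.2.2, `v ∣ p`), and Allen–Newton put the obstruction in words: "These constructions use
`l`-adic interpolation, so are well suited to keeping track of characteristic polynomials, and
local-global compatibility was proved up to semisimplification by Varma for all `v ∤ l`.  But it
doesn't seem possible to understand the monodromy operator in this way."  This file PROVES the
mathematical content of that sentence, in the vocabulary of the summit statement
(`FramedRep`, `WeilDeligneRep`, the Grothendieck–Deligne recipe `IsWeilDeligneOfLadic` of
`LocalGlobalCompatibleAt` at `v ∤ ℓ`, Varma's `≺_I` = `WeilDeligneRep.PrecI`): the condition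
"`N ≠ 0`" (more generally "`N` has Jordan type `ν`") is NOT CLOSED under limits of Galois
representations, even under limits inside ONE isomorphism class, whereas every attached
Weil–Deligne representation of the limit has `N = 0`; so no argument whose only local input is
"`r` is a limit of representations with monodromy of type `ν` and bounded (even constant)
inertial / Hodge type" can conclude that `N(r)` has type `ν` — only `N(r) ≺ ν`, which is what is
printed.

## What the sources print

* P. Allen, J. Newton, *Monodromy for some rank two Galois representations over CM fields*,
  Doc. Math. 25 (2020), §1 (arXiv:1901.05490 p. 1): the sentence quoted above; Thm. 1.1: for `π`
  regular algebraic cuspidal on `GL₂(𝔸_F)`, `F` CM, of weight `0`, there is a set of primes `l`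
  of Dirichlet density one with `ι WD(r_ι(π)|_{G_{F_v}})^{F-ss} ≅ rec_{F_v}(π_v |det|^{-1/2})` for
  all finite `v ∤ l`; "Method of proof": "we need to prove that if `v ∤ l` is a finite place of
  `F` at which `π` is special, then `r_ι(π)|_{G_{F_v}}` has nontrivial monodromy", done by
  automorphy lifting (Luu's strategy: an unramified `r_ι(π)` at a Steinberg place would be
  automorphic of a level unramified at `v`, contradicting strong multiplicity one) after a
  potential-automorphy step, or, for Hilbert partial weight one, by "a `p`-adic version of
  Mazur's principle". [cite: AllenNewton2020, §1 and Thm. 1.1]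
* I. Varma, *Local–global compatibility for regular algebraic cuspidal automorphic
  representations when `ℓ ≠ p`*, Forum Math. Sigma 12 (2024) (arXiv:1411.2520): Thm. 1
  (`WD(r_p(π)|_{G_{F_v}})^{ss} = ı⁻¹rec(π_v ⊗ |det|^{(1-n)/2})^{ss}`, all `v ∤ p`) and Thm. 2
  (`WD(…)^{F-ss} ≺ ı⁻¹rec(…)`), the representation being obtained from "linear combinations of
  classical cusp forms … whose Hecke eigenvalues are congruent mod `p^k` to those of `Π(M)` for
  each positive `k`" through a pseudorepresentation `T` and "a continuous semisimple Galois
  representation … whose trace is equal to `T`"; Def. 8.2 (`≺`), Def. 8.3 (`≺_I`, the tree's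
  `WeilDeligneRep.PrecI`). [cite: VarmaFMS2024, Thm. 2 and Def. 8.3]
* L. A'Campo, B. Hevesi, J. A. Thorne, D. Whitmore, arXiv:2607.11763 (2026): Thm. 1.2.1
  (`v ∣ p`: `r_{π,ι}|_{G_{F_v}}` de Rham with the predicted Hodge–Tate weights and
  `WD(…)^{ss} ≅ ι⁻¹rec^T(π_v)^{ss}`), Cor. 1.2.2 (`WD(…)^{F-ss} ≺ ι⁻¹rec^T(π_v)`); §1 p. 5: "This
  approach is harder to apply when `v ∣ p`, because `p`-adic limits of de Rham Galois
  representations of `G_{F_v}` need not be de Rham"; §1.2.4: "if `r_{π,ι}` can be presented as a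
  `p`-adic limit of Galois representations satisfying such conditions [crystalline with given
  Hodge–Tate weights, Kisin], then it will also satisfy these conditions" (CLOSED conditions pass
  to the limit); §6, Lemma 6.0.3: "Suppose that `N` lies in the closure of the `G(r)`-orbit of
  `N′`. Then `(r, N) ≺ (r, N′)`"; Prop. 6.0.5: `G(r)` has finitely many orbits on
  `P(r) = Hom_{W_K}(V, V(−1))`, the generic `N` form the open orbit, and `(r, N) ≺ (r, N′)` for
  generic `N′`; Cor. 6.0.6 (semisimplified compatibility ⇒ `≺`).
  [cite: AHTW2026, Cor. 1.2.2 and Lemma 6.0.3]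
* J. Bellaïche, G. Chenevier, *Families of Galois representations and Selmer groups*,
  Astérisque 324 (2009), §7.8.1, Prop. 7.8.1 (Gerstenhaber): for nilpotent `n, n′ ∈ M_d(k)` the
  following are equivalent: (i) `n` is in the Zariski-closure of the conjugacy class of `n′`,
  (ii) `rank nⁱ ≤ rank n′ⁱ` for all `i`, (iii) `t(n) ≺ t(n′)` (dominance of Jordan partitions);
  Def. 7.8.2, Def. 7.8.19 (`≺_{I_F}` on Weil–Deligne representations: "`(ρ₁,N₁)` is in the
  Zariski-closure of the conjugacy class of `(ρ₂,N₂)`"); Prop. 7.8.20 (iii): in a `p`-adic family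
  at `l ≠ p`, `N̄_x ≺_{I_F} N^{gen}_{s(x)}` (SEMICONTINUITY of monodromy under specialisation,
  never equality); Prop. 7.5.7–7.5.8 (its use on eigenvarieties: `N̄_x ≺ N^{gen} ≺ N₀`).
  [cite: BellaicheChenevier2009, Prop. 7.8.1 and Prop. 7.8.20]
* S. Bloch, K. Kato, *L-functions and Tamagawa numbers of motives* (1990), remark after (3.7.4)
  (p. 354): a class `a ∈ H¹(K, V)`, i.e. an extension `0 → V → E → ℚ_p → 0`, with `V` crystalline
  is crystalline iff `a ∈ H¹_f(K, V)`; Example 3.9 (p. 359): for `V = ℚ_p(1)`,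
  `dim H¹_f(K, ℚ_p(1)) = [K:ℚ_p] < dim H¹(K, ℚ_p(1)) = [K:ℚ_p] + 1` and "`H¹_f(K, ℚ_p(1))` is the
  image of the exponential map", the Kummer image of the units (the `v ∣ p` twin below).
  [cite: BlochKato1990, Example 3.9]
* J. Silverman, *Advanced Topics in the Arithmetic of Elliptic Curves* (1994), Thm. V.3.1 (Tate:
  `φ : K̄^×/q^ℤ ≅ E_q(K̄)` compatibly with `G_{K̄/K}`) and Prop. V.6.1 with its proof (for
  `ℓ ∤ ord_v q`, some `σ` in the INERTIA group acts on `E_q[ℓ]`, in the basis `φ(ζ), φ(q^{1/ℓ})`,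
  by the transvection `(1 1; 0 1)`): the `ℓ`-adic Tate module of a Tate curve is an
  upper-triangular representation `(ε_ℓ *; 0 1)` of `Γ_K` with infinite, unipotent image of
  inertia, i.e. (Grothendieck–Deligne, `ℓ ≠ p`) with attached Weil–Deligne representation of
  Steinberg type, `N ≠ 0` — the witnesses of the hypothesis of the theorem below exist in nature.
  [cite: SilvermanATAEC1994, Thm. V.3.1 and Prop. V.6.1]
* P. Deligne, *Les constantes des équations fonctionnelles des fonctions `L`* (1973), §8.4.2, and
  J. Tate, *Number theoretic background* (1979), (4.1.4) `sp(n)`, (4.2.1): the dictionary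
  `ρ ↦ (ρ_WD, N)`, `ρ(u) = exp(t_ℓ(u) N)` on an open subgroup of inertia — the tree's relation
  `IsWeilDeligneOfLadic`, with its proved uniqueness `IsWeilDeligneOfLadic.isEquivalent_holds`.
  [cite: DeligneAntwerpII1973, §8.4.2]

## What this file proves (everything below is a theorem or a definition with a body; no named fact)

1. `WeilDeligneRep.transport / transportEquiv / glConj`, `IsWeilDeligneOfLadic.glConj`: change of
   frame `g ∈ GL_n` transports Weil–Deligne representations isomorphically and leaves the
   Grothendieck–Deligne recipe invariant (`g exp(tN) g⁻¹ = exp(t gNg⁻¹)`);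
   `WeilDeligneRep.IsEquivalent.N_eq_zero`: `N = 0` is an isomorphism invariant;
   `N_eq_zero_of_isWeilDeligneOfLadic_of_ker`: a `ρW` with FINITE inertia image (trivial on the
   open `U` carrying the tame character) has `(ρW, 0)` attached and EVERY attached Weil–Deligne
   representation has `N = 0`.
2. `steinbergWD F C b = (‖·‖ ⊕ 1, N = b·E₀₁)` on `C²` (§3): for `b ≠ 0` one isomorphism class
   (`steinbergWD_isEquivalent`, the `GL₂`-orbit of `sp(2)`), `St(0)` not in it
   (`not_isEquivalent_steinbergWD_zero`) but in its closure (`tendsto_toMatrix'_steinbergWD_N`: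
   `St(b_m) → St(0)` entrywise for `b_m → 0`) and `St(0) ≺_I St(b)` (`steinbergWD_zero_precI`):
   the `n = 2` instance of Gerstenhaber / Bellaïche–Chenevier Prop. 7.8.1 and of AHTW Lemma 6.0.3
   with `N = 0`, proved.
3. The Galois-level construction (§§4–6): for an upper-triangular `ρ : Γ_F →ₜ* GL₂(E)`
   (`IsUpperTriangular`; `E` a normed field of characteristic `0`, e.g. `ℚ̄_ℓ`) with a
   Weil–Deligne representation `r`, `N ≠ 0`, attached to `ρ|_{W_F}` by the recipe, the conjugates
   `ρ_m = d(c_m) ρ d(c_m)⁻¹`, `d(c) = diag(1, c⁻¹)` (`scaleGL`), `c_m → 0`: (i) are attached to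
   the transported `d(c_m) r d(c_m)⁻¹ ≅ r`, `N ≠ 0` — CONSTANT isomorphism class, hence constant
   inertial type, conductor, Hodge type, everything an isomorphism invariant can see — and have
   the same traces and characteristic polynomials as `ρ` and as `ρ^{diag} = ρ₀₀ ⊕ ρ₁₁`
   (`trace_conj`, `trace_diagPart`, `charpoly_diagPart`: the pseudocharacter is CONSTANT along the
   sequence); (ii) converge to `ρ^{diag}` uniformly on `Γ_F` in the frame
   (`TendstoUniformlyInFrame`, `tendstoUniformlyInFrame_conj_scaleGL`; `Γ_F` compact); (iii) the
   recipe forces `N` strictly upper triangular and `ρ = 1 + t(u)N` unipotent with trivial diagonal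
   on `U` (`toMatrix'_N_entries`), so `ρ^{diag}` is trivial on `U`
   (`diagPart_toWeilGroupHom_eq_one`), `(ρ^{diag}|_{W_F}, 0)` is attached to it and EVERY
   Weil–Deligne representation attached to the limit has `N = 0` (`monodromy_not_closed`).
4. `LadicLimitsPreserveMonodromy F E` — the TECHNIQUE-CLASS lemma (the weakest statement every
   "`N` from limits" argument needs) — and its refutation `not_ladicLimitsPreserveMonodromy` from
   the existence of one upper-triangular Steinberg-attached `ρ`; the closed statement
   `MonodromyNotClosedUnderPadicLimits` with `MonodromyNotClosedUnderPadicLimits_holds`.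

## The `v ∣ p` twin (not formalised; same mechanism)

Over `ℚ_p` with `p`-adic coefficients the same degeneration is realised INSIDE p-adic Hodge
theory by Kummer theory: `H¹(G_{ℚ_p}, ℚ_p(1)) = ℚ_p^× ⊗̂ ℚ_p ⊋ H¹_f = ℤ_p^× ⊗̂ ℚ_p` (Bloch–Kato,
Example 3.9), the classes `κ(q_m)`, `q_m = p^{p^m}u` (`u ∈ ℤ_p^×`, `log_p u ≠ 0`), lie outside
`H¹_f` — the extensions `V_p(E_{q_m})` of `ℚ_p` by `ℚ_p(1)` (Tate curves) are semistable
NON-crystalline, `N ≠ 0`, Hodge–Tate weights `{0,1}`, trivial inertial type — and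
`κ(q_m) = p^m κ(p) + κ(u) → κ(u) ∈ H¹_f`, a CRYSTALLINE extension, `N = 0` (remark after (3.7.4)).
It is not stated in Lean here: the summit's `p`-adic Hodge datum `ReciprocityData.pst`
(`PstWeilDeligneData`, Fontaine's `WD ∘ D_pst`) is pinned by specification and does not let the
tree compute `N` of a given de Rham representation (definition items D1/D2 of the summit); see
`scope_caveats` of `MonodromyNotClosedUnderPadicLimits`.

## References

* [AN2020] P. B. Allen, J. Newton, Doc. Math. 25 (2020) 2487–2506, §1, Thm. 1.1, Thm. 1.2.
  [cite: AllenNewton2020, §1 and Thm. 1.1]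
* [Var2024] I. Varma, Forum Math. Sigma 12 (2024) e21, Thm. 1, Thm. 2, Def. 8.2, Def. 8.3.
  [cite: VarmaFMS2024, Thm. 2 and Def. 8.3]
* [AHTW2026] L. A'Campo, B. Hevesi, J. A. Thorne, D. Whitmore, arXiv:2607.11763, Thm. 1.2.1,
  Cor. 1.2.2, §1.2.4, Lemma 6.0.3, Prop. 6.0.5, Cor. 6.0.6. [cite: AHTW2026, Cor. 1.2.2 and Lemma 6.0.3]
* [BC2009] J. Bellaïche, G. Chenevier, Astérisque 324 (2009), Prop. 7.8.1, Def. 7.8.2, Def. 7.8.19,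
  Prop. 7.8.20, Prop. 7.5.7–7.5.8. [cite: BellaicheChenevier2009, Prop. 7.8.1 and Prop. 7.8.20]
* [BK1990] S. Bloch, K. Kato, Grothendieck Festschrift I (1990), (3.7.2)–(3.7.4) and the remark
  following, Example 3.9. [cite: BlochKato1990, Example 3.9]
* [Sil1994] J. H. Silverman, GTM 151 (1994), Thm. V.3.1, Prop. V.6.1. [cite: SilvermanATAEC1994, Thm. V.3.1 and Prop. V.6.1]
* [Del1973] P. Deligne, Antwerp II, LNM 349 (1973), §8.4.1–8.4.2. [cite: DeligneAntwerpII1973, §8.4.2]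
* [Tate1979] J. Tate, Corvallis, PSPM 33.2 (1979), (4.1.3), (4.1.4), (4.2.1). [cite: TateCorvallis1979, (4.1.4)]
* [HLTT2016] M. Harris, K.-W. Lan, R. Taylor, J. Thorne, Res. Math. Sci. 3 (2016) 37, Thm. A
  (p. 3: "a unique continuous semi-simple representation `r_{p,ı}(π)`" with
  `r_{p,ı}(π)|^{ss}_{W_{E_v}} = ı⁻¹rec(π_v |det|^{(1-n)/2})^{ss}` at unramified `v ∤ p`; "Rather we
  construct it as a `p`-adic limit of representations which do occur in such cohomology
  groups"). [cite: HarrisLanTaylorThorneRMS2016, Thm. A]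
* [Sch2015] P. Scholze, Ann. of Math. 182 (2015), Introduction, Thm. 4 (Galois representations
  for regular L-algebraic cuspidal `π` over totally real or CM `F`, obtained "in the inverse
  limit over `m`" from `H^i(X_K, ℤ/p^m)`) and Thm. 5 (`p`-adic interpolation of Hecke
  eigenvalues by classical cusp forms). [cite: Scholze2015, Introduction, Thm. 4 and Thm. 5]
* [Car2014] A. Caraiani, Algebra Number Theory 8 (2014), Thm. 1.1 (`Π^∨ ≅ Π ∘ c` cohomological:
  `WD(R_l(Π)|_{Gal(L̄_y/L_y)})^{F-ss} ≅ ι_l⁻¹ 𝓛_{n,L_y}(Π_y)` at `y ∣ l`, monodromy included).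
  [cite: Caraiani2014, Thm. 1.1]
-/

noncomputable section

open Filter Topology Matrix
open Literature.NumberTheory.GaloisRepresentations

namespace Literature.Barriers.Langlands

/-! ## 1. Transport of Weil–Deligne representations; conjugation-invariance of the `ℓ`-adic recipe -/

section Transport

variable {F : Type*} [Field F] [ValuativeRel F] [TopologicalSpace F] [IsNonarchimedeanLocalField F]
variable {C : Type*} [Field C] [CharZero C]
variable {V V' : Type*} [AddCommGroup V] [Module C V] [AddCommGroup V'] [Module C V']

omit [CharZero C] in
/-- Powers commute with conjugation by a linear isomorphism: `(e f e⁻¹)^k = e f^k e⁻¹`. [folklore] -/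
theorem conj_pow (e : V ≃ₗ[C] V') (f : Module.End C V) (k : ℕ) : (e.conj f) ^ k = e.conj (f ^ k) := by
  induction k with
  | zero =>
    rw [pow_zero, pow_zero]
    exact e.conj_id.symm
  | succ k ih =>
    rw [pow_succ, pow_succ, ih, Module.End.mul_eq_comp, Module.End.mul_eq_comp, LinearEquiv.conj_comp]

/-- **Transport of structure** of a Weil–Deligne representation `(ρ, N)` on `V` along a linear
isomorphism `e : V ≃ V'`: `ρ'(w) = e ρ(w) e⁻¹`, `N' = e N e⁻¹` (same open subgroup of inertia in
the kernel, `N'` nilpotent, and the Weil–Deligne relation is transported).  For `V = V'` this is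
the action of `GL(V)` on Weil–Deligne representations with fixed space whose orbits are the
isomorphism classes. [cite: DeligneAntwerpII1973, §8.4.1] -/
def _root_.Literature.NumberTheory.GaloisRepresentations.WeilDeligneRep.transport
    (r : WeilDeligneRep F C V) (e : V ≃ₗ[C] V') : WeilDeligneRep F C V' where
  ρ :=
    { toFun := fun w => e.conj (r.ρ w)
      map_one' := by
        rw [map_one]
        exact e.conj_id
      map_mul' := fun w w' => by
        rw [map_mul, Module.End.mul_eq_comp, LinearEquiv.conj_comp, Module.End.mul_eq_comp] }
  isContinuous := by
    obtain ⟨U, hU, hUo, h⟩ := r.isContinuous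
    refine ⟨U, hU, hUo, fun u hu => ?_⟩
    change e.conj (r.ρ u) = 1
    rw [h u hu]
    exact e.conj_id
  N := e.conj r.N
  isNilpotent_N := by
    obtain ⟨k, hk⟩ := r.isNilpotent_N
    exact ⟨k, by rw [conj_pow, hk, map_zero]⟩
  conj_N w := by
    change e.conj (r.ρ w) ∘ₗ e.conj r.N = _ • (e.conj r.N ∘ₗ e.conj (r.ρ w))
    rw [← LinearEquiv.conj_comp, ← LinearEquiv.conj_comp, r.conj_N w, map_smul]

/-- The Weil-group action of the transported representation. [folklore] -/
@[simp] theorem transport_ρ_apply (r : WeilDeligneRep F C V) (e : V ≃ₗ[C] V') (w : WeilGroup F) :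
    (r.transport e).ρ w = e.conj (r.ρ w) := rfl

/-- The monodromy operator of the transported representation. [folklore] -/
@[simp] theorem transport_N (r : WeilDeligneRep F C V) (e : V ≃ₗ[C] V') :
    (r.transport e).N = e.conj r.N := rfl

/-- Transport along `e` is an ISOMORPHISM of Weil–Deligne representations `r ≅ e·r` (the
isomorphism being `e` itself). [cite: DeligneAntwerpII1973, §8.4.1] -/
def _root_.Literature.NumberTheory.GaloisRepresentations.WeilDeligneRep.transportEquiv
    (r : WeilDeligneRep F C V) (e : V ≃ₗ[C] V') : r.Equiv (r.transport e) where
  toRepEquiv := Representation.Equiv.mk e fun w => LinearMap.ext fun v => by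
    simp [LinearEquiv.conj_apply_apply]
  comm_N := LinearMap.ext fun v => by
    change e (r.N v) = e.conj r.N (e v)
    simp [LinearEquiv.conj_apply_apply]

/-- The transported representation is isomorphic to the original one. [folklore] -/
theorem transport_isEquivalent (r : WeilDeligneRep F C V) (e : V ≃ₗ[C] V') :
    (r.transport e).IsEquivalent r :=
  ⟨(r.transportEquiv e).symm⟩

/-- The monodromy of the transport vanishes iff the original monodromy does. [folklore] -/
theorem transport_N_eq_zero_iff (r : WeilDeligneRep F C V) (e : V ≃ₗ[C] V') :
    (r.transport e).N = 0 ↔ r.N = 0 := by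
  rw [transport_N]
  exact e.conj.map_eq_zero_iff

/-- Isomorphic Weil–Deligne representations have simultaneously vanishing monodromy: `N = 0` is
an invariant of the isomorphism class. [cite: DeligneAntwerpII1973, §8.4.1] -/
theorem _root_.Literature.NumberTheory.GaloisRepresentations.WeilDeligneRep.IsEquivalent.N_eq_zero
    {r : WeilDeligneRep F C V} {r' : WeilDeligneRep F C V'} (he : r.IsEquivalent r') (h0 : r.N = 0) :
    r'.N = 0 := by
  obtain ⟨e⟩ := he
  have hc := e.comm_N
  rw [h0, LinearMap.comp_zero] at hc
  refine LinearMap.ext fun v => ?_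
  obtain ⟨w, rfl⟩ := e.toRepEquiv.toLinearEquiv.surjective v
  have := congr($hc.symm w)
  simpa using this

variable {n : ℕ}

/-- The linear automorphism `v ↦ g v` of `Fin n → C` defined by `g ∈ GL_n(C)` (matrix acting by
`Matrix.toLin'`, inverse given by `g⁻¹`). [folklore] -/
def glLinearEquiv (g : GL (Fin n) C) : (Fin n → C) ≃ₗ[C] (Fin n → C) :=
  LinearEquiv.ofLinear (Matrix.toLin' (g : Matrix (Fin n) (Fin n) C))
    (Matrix.toLin' ((g⁻¹ : GL (Fin n) C) : Matrix (Fin n) (Fin n) C))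
    (by rw [← Matrix.toLin'_mul, Units.mul_inv, Matrix.toLin'_one])
    (by rw [← Matrix.toLin'_mul, Units.inv_mul, Matrix.toLin'_one])

omit [CharZero C] in
/-- Conjugating an endomorphism by `glLinearEquiv g` conjugates its matrix by `g`. [folklore] -/
theorem toMatrix'_conj_glLinearEquiv (g : GL (Fin n) C) (f : Module.End C (Fin n → C)) :
    LinearMap.toMatrix' ((glLinearEquiv g).conj f) =
      (g : Matrix (Fin n) (Fin n) C) * LinearMap.toMatrix' f *
        ((g⁻¹ : GL (Fin n) C) : Matrix (Fin n) (Fin n) C) := by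
  rw [LinearEquiv.conj_apply]
  change LinearMap.toMatrix' (Matrix.toLin' _ ∘ₗ f ∘ₗ Matrix.toLin' _) = _
  rw [LinearMap.toMatrix'_comp, LinearMap.toMatrix'_comp, LinearMap.toMatrix'_toLin',
    LinearMap.toMatrix'_toLin', Matrix.mul_assoc]

/-- **Change of frame** of a Weil–Deligne representation on `Fin n → C` by `g ∈ GL_n(C)`:
`(g ρ g⁻¹, g N g⁻¹)` — the transport along `glLinearEquiv g`. [cite: DeligneAntwerpII1973, §8.4.1] -/
abbrev _root_.Literature.NumberTheory.GaloisRepresentations.WeilDeligneRep.glConj (g : GL (Fin n) C)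
    (r : WeilDeligneRep F C (Fin n → C)) : WeilDeligneRep F C (Fin n → C) :=
  r.transport (glLinearEquiv g)

/-- The truncated exponential of a nilpotent matrix commutes with conjugation by an invertible
matrix: `exp(g A g⁻¹) = g exp(A) g⁻¹` (Mathlib `IsNilpotent.exp_smul` for the conjugation action
of the unit group). [folklore] -/
theorem exp_units_conj (g : GL (Fin n) C) {A : Matrix (Fin n) (Fin n) C} (hA : IsNilpotent A) :
    IsNilpotent.exp ((g : Matrix (Fin n) (Fin n) C) * A * ((g⁻¹ : GL (Fin n) C) : Matrix (Fin n) (Fin n) C)) =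
      (g : Matrix (Fin n) (Fin n) C) * IsNilpotent.exp A *
        ((g⁻¹ : GL (Fin n) C) : Matrix (Fin n) (Fin n) C) := by
  have h := IsNilpotent.exp_smul (ConjAct.toConjAct g) hA
  rwa [ConjAct.units_smul_def, ConjAct.units_smul_def, ConjAct.ofConjAct_toConjAct] at h

/-- The matrix of the monodromy operator of a Weil–Deligne representation on `Fin n → C` is
nilpotent. [folklore] -/
theorem isNilpotent_toMatrix'_N (r : WeilDeligneRep F C (Fin n → C)) :
    IsNilpotent (LinearMap.toMatrix' r.N) := by
  obtain ⟨k, hk⟩ := r.isNilpotent_N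
  refine ⟨k, ?_⟩
  have : (LinearMap.toMatrix' r.N) ^ k = LinearMap.toMatrixAlgEquiv' (r.N ^ k) := by
    rw [map_pow]; rfl
  rw [this, hk, map_zero]

/-- **The Grothendieck–Deligne recipe is invariant under change of frame.**  If `r = (ρ_WD, N)`
is attached to `ρW : W_F → GL_n(C)` by the printed recipe `IsWeilDeligneOfLadic` (tame character
`t`, open `U ≤ I_F`, geometric Frobenius `Φ`), then for every `g ∈ GL_n(C)` the conjugate
`g r g⁻¹` is attached to `g ρW g⁻¹` by the SAME `(t, U, Φ)`:
`g exp(t(u) N) g⁻¹ = exp(t(u) · g N g⁻¹)`. [cite: DeligneAntwerpII1973, §8.4.2] -/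
theorem IsWeilDeligneOfLadic.glConj {ρW : WeilGroup F →* GL (Fin n) C}
    {r : WeilDeligneRep F C (Fin n → C)} (h : IsWeilDeligneOfLadic ρW r) (g : GL (Fin n) C) :
    IsWeilDeligneOfLadic ((MulAut.conj g).toMonoidHom.comp ρW) (r.glConj g) := by
  obtain ⟨t, U, Φ, hU, hUo, hΦ, ht, h1, h2⟩ := h
  have hN : IsNilpotent (LinearMap.toMatrix' r.N) := isNilpotent_toMatrix'_N r
  have key : ∀ u : WeilGroup.inertia F,
      (t u).toAdd • LinearMap.toMatrix' (r.glConj g).N =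
        (g : Matrix (Fin n) (Fin n) C) * ((t u).toAdd • LinearMap.toMatrix' r.N) *
          ((g⁻¹ : GL (Fin n) C) : Matrix (Fin n) (Fin n) C) := fun u => by
    rw [WeilDeligneRep.glConj, transport_N, toMatrix'_conj_glLinearEquiv, mul_smul_comm,
      smul_mul_assoc]
  refine ⟨t, U, Φ, hU, hUo, hΦ, ht, fun u hu => ?_, fun m u => ?_⟩
  · rw [key u, exp_units_conj g (hN.smul _), ← h1 u hu]
    rfl
  · have hneg : -((t u).toAdd • LinearMap.toMatrix' (r.glConj g).N) =
        (g : Matrix (Fin n) (Fin n) C) * (-((t u).toAdd • LinearMap.toMatrix' r.N)) *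
          ((g⁻¹ : GL (Fin n) C) : Matrix (Fin n) (Fin n) C) := by
      rw [key u, Matrix.mul_neg, Matrix.neg_mul]
    rw [hneg, exp_units_conj g (hN.smul _).neg]
    change LinearMap.toMatrix' ((glLinearEquiv g).conj (r.ρ (Φ ^ m * u))) =
      ((g * ρW (Φ ^ m * u) * g⁻¹ : GL (Fin n) C) : Matrix (Fin n) (Fin n) C) * _
    rw [toMatrix'_conj_glLinearEquiv, h2 m u, Units.val_mul, Units.val_mul]
    simp only [Matrix.mul_assoc, Units.inv_mul_cancel_left]

omit [CharZero C] in
/-- The matrix of the standard representation of `GL_n(C)` on `Fin n → C` at `g` is `g`. [folklore] -/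
theorem toMatrix'_glStdRepresentation (g : GL (Fin n) C) :
    LinearMap.toMatrix' (glStdRepresentation (Fin n) C g) = (g : Matrix (Fin n) (Fin n) C) := by
  ext i j
  rw [LinearMap.toMatrix'_apply, glStdRepresentation_apply, Matrix.mulVec_single_one]
  rfl

/-- **The Weil–Deligne representation `(ρW, 0)` of a homomorphism `ρW : W_F → GL_n(C)` which is
trivial on an open subgroup `U` of inertia** (finite image of inertia): the representation
`w ↦ (v ↦ ρW(w) v)` on `Fin n → C` with trivial monodromy (`WeilDeligneRep.ofRep`).
[cite: TateCorvallis1979, (4.1.3)] -/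
def _root_.Literature.NumberTheory.GaloisRepresentations.WeilDeligneRep.ofGLHom
    (ρW : WeilGroup F →* GL (Fin n) C) (U : Subgroup (WeilGroup F)) (hU : U ≤ WeilGroup.inertia F)
    (hUo : IsOpen (U : Set (WeilGroup F))) (hker : ∀ u ∈ U, ρW u = 1) :
    WeilDeligneRep F C (Fin n → C) :=
  WeilDeligneRep.ofRep ((glStdRepresentation (Fin n) C).comp ρW)
    ⟨U, hU, hUo, fun u hu => by rw [MonoidHom.comp_apply, hker u hu, map_one]⟩

/-- `ofGLHom` has trivial monodromy. [cite: TateCorvallis1979, (4.1.3)] -/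
@[simp] theorem ofGLHom_N (ρW : WeilGroup F →* GL (Fin n) C) (U : Subgroup (WeilGroup F))
    (hU : U ≤ WeilGroup.inertia F) (hUo : IsOpen (U : Set (WeilGroup F)))
    (hker : ∀ u ∈ U, ρW u = 1) : (WeilDeligneRep.ofGLHom ρW U hU hUo hker).N = 0 := rfl

/-- The matrices of `ofGLHom ρW` are those of `ρW`. [folklore] -/
theorem toMatrix'_ofGLHom_ρ (ρW : WeilGroup F →* GL (Fin n) C) (U : Subgroup (WeilGroup F))
    (hU : U ≤ WeilGroup.inertia F) (hUo : IsOpen (U : Set (WeilGroup F)))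
    (hker : ∀ u ∈ U, ρW u = 1) (w : WeilGroup F) :
    LinearMap.toMatrix' ((WeilDeligneRep.ofGLHom ρW U hU hUo hker).ρ w) =
      ((ρW w : GL (Fin n) C) : Matrix (Fin n) (Fin n) C) :=
  toMatrix'_glStdRepresentation (ρW w)

/-- **Finite inertia ⇒ `N = 0` for EVERY attached Weil–Deligne representation.**  If
`ρW : W_F → GL_n(C)` is trivial on an open subgroup `U ≤ I_F` carrying a character `t` which is
non-trivial on `U`, and `Φ` is a geometric Frobenius, then `(ρW, 0)` is attached to `ρW` by the
recipe, and by the independence of choices (`IsWeilDeligneOfLadic.isEquivalent_holds`, Deligne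
§8.4.2) every Weil–Deligne representation attached to `ρW` has `N = 0`.
[cite: DeligneAntwerpII1973, §8.4.2] -/
theorem N_eq_zero_of_isWeilDeligneOfLadic_of_ker (ρW : WeilGroup F →* GL (Fin n) C)
    (t : WeilGroup.inertia F →* Multiplicative C) (U : Subgroup (WeilGroup F))
    (hU : U ≤ WeilGroup.inertia F) (hUo : IsOpen (U : Set (WeilGroup F)))
    (ht : ∃ u : WeilGroup.inertia F, (u : WeilGroup F) ∈ U ∧ t u ≠ 1) (hker : ∀ u ∈ U, ρW u = 1)
    (Φ : WeilGroup F) (hΦ : WeilGroup.deg Φ = -1) :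
    IsWeilDeligneOfLadic ρW (WeilDeligneRep.ofGLHom ρW U hU hUo hker) ∧
      ∀ r : WeilDeligneRep F C (Fin n → C), IsWeilDeligneOfLadic ρW r → r.N = 0 := by
  have h0 : IsWeilDeligneOfLadic ρW (WeilDeligneRep.ofGLHom ρW U hU hUo hker) :=
    IsWeilDeligneOfLadic.of_N_eq_zero ρW _ rfl t U hU hUo ht hker Φ hΦ
      fun m u => toMatrix'_ofGLHom_ρ ρW U hU hUo hker _
  exact ⟨h0, fun r hr =>
    (IsWeilDeligneOfLadic.isEquivalent_holds ρW _ r h0 hr).N_eq_zero (ofGLHom_N ρW U hU hUo hker)⟩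

end Transport

/-! ## 2. The change of frame `d(c) = diag(1, c⁻¹)` -/

section Scale

variable {E : Type*} [CommRing E]

/-- The change of frame `d(c) = diag(1, c⁻¹) ∈ GL₂(E)`, `c` a unit: conjugation by `d(c)`
multiplies the `(0,1)` entry by `c` and fixes the diagonal. [folklore] -/
def scaleGL (c : Eˣ) : GL (Fin 2) E where
  val := Matrix.diagonal ![(1 : E), ((c⁻¹ : Eˣ) : E)]
  inv := Matrix.diagonal ![(1 : E), (c : E)]
  val_inv := by
    rw [Matrix.diagonal_mul_diagonal, ← Matrix.diagonal_one]
    congr 1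
    funext i
    fin_cases i <;> simp
  inv_val := by
    rw [Matrix.diagonal_mul_diagonal, ← Matrix.diagonal_one]
    congr 1
    funext i
    fin_cases i <;> simp

/-- The matrix of `d(c)`. [folklore] -/
theorem coe_scaleGL (c : Eˣ) :
    ((scaleGL c : GL (Fin 2) E) : Matrix (Fin 2) (Fin 2) E) =
      Matrix.diagonal ![(1 : E), ((c⁻¹ : Eˣ) : E)] := rfl

/-- The matrix of `d(c)⁻¹`. [folklore] -/
theorem coe_scaleGL_inv (c : Eˣ) :
    (((scaleGL c)⁻¹ : GL (Fin 2) E) : Matrix (Fin 2) (Fin 2) E) =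
      Matrix.diagonal ![(1 : E), (c : E)] := rfl

end Scale

/-! ## 3. The orbit of the Steinberg parameter is not closed: `Sp₂`-type representations degenerate to `N = 0` -/

section OrbitClosure

open WeilGroup
open Literature.NumberTheory.GaloisRepresentations.IsNonarchimedeanLocalField (residueFieldCard
  residueFieldCard_ne_zero)

variable (F : Type*) [Field F] [ValuativeRel F] [TopologicalSpace F] [IsNonarchimedeanLocalField F]
variable (C : Type*) [Field C] [CharZero C]

/-- The diagonal `(q^k, 1)` of the unramified Weil-group representation `‖·‖ ⊕ 1` at an element of
degree `k` (`q` the residue cardinality of `F`). [cite: TateCorvallis1979, (4.1.4)] -/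
def stDiag (k : ℤ) : Fin 2 → C := ![(residueFieldCard F : C) ^ k, 1]

omit [CharZero C] in
/-- `stDiag 0 = 1`. [folklore] -/
theorem stDiag_zero : stDiag F C 0 = fun _ => 1 := by
  funext i
  revert i
  simp [Fin.forall_fin_two, stDiag]

/-- `stDiag (k + l) = stDiag k * stDiag l` (`q ≠ 0` in characteristic `0`). [folklore] -/
theorem stDiag_add (k l : ℤ) : stDiag F C (k + l) = stDiag F C k * stDiag F C l := by
  have hq : (residueFieldCard F : C) ≠ 0 := Nat.cast_ne_zero.2 (residueFieldCard_ne_zero F)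
  funext i
  revert i
  simp [Fin.forall_fin_two, stDiag, zpow_add₀ hq]

/-- **The Weil-group representation `‖·‖ ⊕ 1`** on `C²`: `w ↦ diag(q^{deg w}, 1)` (unramified;
`deg` is a homomorphism by the discharged `LocalGaloisGroup` facts `IsFrobPow.mul_holds`,
`IsFrobPow.unique_holds`). [cite: TateCorvallis1979, (4.1.4)] -/
def steinbergRep : Representation C (WeilGroup F) (Fin 2 → C) where
  toFun w := Matrix.toLin' (Matrix.diagonal (stDiag F C (deg w)))
  map_one' := by
    rw [deg_one IsFrobPow.mul_holds IsFrobPow.unique_holds, stDiag_zero, Matrix.diagonal_one,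
      Matrix.toLin'_one]
    rfl
  map_mul' w w' := by
    rw [deg_mul IsFrobPow.mul_holds IsFrobPow.unique_holds, stDiag_add, Pi.mul_def,
      ← Matrix.diagonal_mul_diagonal, Matrix.toLin'_mul]
    rfl

/-- `‖·‖ ⊕ 1` is unramified (`deg = 0` on inertia). [cite: TateCorvallis1979, (4.1.4)] -/
theorem isUnramifiedRep_steinbergRep : IsUnramifiedRep (steinbergRep F C) := fun u hu => by
  change Matrix.toLin' (Matrix.diagonal (stDiag F C (deg u))) = 1
  rw [(deg_eq_zero_iff_mem_inertia IsFrobPow.mul_holds IsFrobPow.unique_holds).2 hu, stDiag_zero,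
    Matrix.diagonal_one, Matrix.toLin'_one]
  rfl

omit [CharZero C] in
/-- The Weil–Deligne relation for `(‖·‖ ⊕ 1, b·E₀₁)` in matrices:
`diag(q^k, 1) · (b E₀₁) = q^k • (b E₀₁) · diag(q^k, 1)`. [cite: TateCorvallis1979, (4.1.4)] -/
theorem diagonal_stDiag_mul_single (k : ℤ) (b : C) :
    Matrix.diagonal (stDiag F C k) * Matrix.single 0 1 b =
      ((residueFieldCard F : C) ^ k) • (Matrix.single 0 1 b * Matrix.diagonal (stDiag F C k)) := by
  ext i j
  revert i j
  simp [Fin.forall_fin_two, Matrix.diagonal_mul, Matrix.mul_diagonal, stDiag, Matrix.single_apply]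

/-- **The Steinberg-type family `St(b) = (‖·‖ ⊕ 1, N = b·E₀₁)`, `b ∈ C`**, of Weil–Deligne
representations on `C²`: for `b ≠ 0` the special representation `sp(2)` (up to unramified twist,
Tate's `sp(n)`: `N e_i = e_{i+1}` with `ρ = ⊕ ω^i`), i.e. the parameter of a twist of the
Steinberg representation / of an elliptic curve with split multiplicative reduction; for `b = 0`
the unramified principal-series parameter `‖·‖ ⊕ 1` with `N = 0`.  All `St(b)`, `b ≠ 0`, are
ISOMORPHIC (one `GL₂(C)`-orbit, `steinbergWD_isEquivalent`); `St(0)` is not isomorphic to them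
(`not_isEquivalent_steinbergWD_zero`) but is the entrywise LIMIT of `St(b_m)` for any `b_m → 0`
(`tendsto_toMatrix'_steinbergWD_N`): the orbit `{N ≠ 0}` is not closed and `0` lies in its
closure (Bellaïche–Chenevier, Prop. 7.8.1 (i)⇔(iii); A'Campo–Hevesi–Thorne–Whitmore, Lemma 6.0.3).
[cite: TateCorvallis1979, (4.1.4)] -/
def steinbergWD (b : C) : WeilDeligneRep F C (Fin 2 → C) where
  ρ := steinbergRep F C
  isContinuous := (isUnramifiedRep_steinbergRep F C).isContinuousRep
  N := Matrix.toLin' (Matrix.single 0 1 b)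
  isNilpotent_N := ⟨2, by
    rw [pow_two, Module.End.mul_eq_comp, ← Matrix.toLin'_mul,
      Matrix.single_mul_single_of_ne (h := by decide), map_zero]⟩
  conj_N w := by
    change Matrix.toLin' (Matrix.diagonal (stDiag F C (deg w))) ∘ₗ Matrix.toLin' _ =
      _ • (Matrix.toLin' _ ∘ₗ Matrix.toLin' (Matrix.diagonal (stDiag F C (deg w))))
    rw [← Matrix.toLin'_mul, ← Matrix.toLin'_mul, ← map_smul, diagonal_stDiag_mul_single]

/-- The matrix of the monodromy of `St(b)` is `b·E₀₁`. [folklore] -/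
@[simp] theorem toMatrix'_steinbergWD_N (b : C) :
    LinearMap.toMatrix' (steinbergWD F C b).N = Matrix.single 0 1 b :=
  LinearMap.toMatrix'_toLin' _

/-- All `St(b)` have the same Weil-group action `‖·‖ ⊕ 1`. [folklore] -/
@[simp] theorem steinbergWD_ρ (b : C) : (steinbergWD F C b).ρ = steinbergRep F C := rfl

/-- `St(b)` has trivial monodromy iff `b = 0`. [folklore] -/
theorem steinbergWD_N_eq_zero_iff (b : C) : (steinbergWD F C b).N = 0 ↔ b = 0 := by
  constructor
  · intro h
    have h' := congrArg LinearMap.toMatrix' h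
    rw [toMatrix'_steinbergWD_N, map_zero] at h'
    simpa using congr_fun (congr_fun h' 0) 1
  · rintro rfl
    change Matrix.toLin' (Matrix.single 0 1 (0 : C)) = 0
    rw [Matrix.single_zero, map_zero]

/-- **One orbit**: for `b, b' ≠ 0`, `St(b) ≅ St(b')`, the isomorphism being `diag(1, b/b')`
(it commutes with the diagonal `ρ` and carries `b E₀₁` to `b' E₀₁`). [cite: BellaicheChenevier2009, Prop. 7.8.1] -/
theorem steinbergWD_isEquivalent {b b' : C} (hb : b ≠ 0) (hb' : b' ≠ 0) :
    (steinbergWD F C b).IsEquivalent (steinbergWD F C b') := by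
  let u : Cˣ := Units.mk0 (b' / b) (div_ne_zero hb' hb)
  let e := glLinearEquiv (scaleGL u)
  have he : (e : (Fin 2 → C) →ₗ[C] (Fin 2 → C)) = Matrix.toLin' (Matrix.diagonal ![(1 : C), b / b']) := by
    change Matrix.toLin' _ = _
    rw [coe_scaleGL]
    congr 2
    funext i; revert i
    simp [u, div_eq_mul_inv]
  refine ⟨{ toRepEquiv := Representation.Equiv.mk e fun w => ?_, comm_N := ?_ }⟩
  · rw [he]
    change Matrix.toLin' _ ∘ₗ Matrix.toLin' (Matrix.diagonal (stDiag F C (deg w))) =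
      Matrix.toLin' (Matrix.diagonal (stDiag F C (deg w))) ∘ₗ Matrix.toLin' _
    rw [← Matrix.toLin'_mul, ← Matrix.toLin'_mul, Matrix.diagonal_mul_diagonal,
      Matrix.diagonal_mul_diagonal]
    congr 2
    funext i
    apply mul_comm
  · change (e : (Fin 2 → C) →ₗ[C] (Fin 2 → C)) ∘ₗ Matrix.toLin' (Matrix.single 0 1 b) =
      Matrix.toLin' (Matrix.single 0 1 b') ∘ₗ (e : (Fin 2 → C) →ₗ[C] (Fin 2 → C))
    rw [he, ← Matrix.toLin'_mul, ← Matrix.toLin'_mul]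
    congr 1
    ext i j
    revert i j
    simp [Fin.forall_fin_two, Matrix.diagonal_mul, Matrix.mul_diagonal, Matrix.single_apply]
    rw [mul_comm, div_mul_cancel₀ b hb']

/-- **Not in the orbit**: `St(0)` (`N = 0`) is not isomorphic to `St(b)`, `b ≠ 0` (`N ≠ 0`).
[cite: BellaicheChenevier2009, Prop. 7.8.1] -/
theorem not_isEquivalent_steinbergWD_zero {b : C} (hb : b ≠ 0) :
    ¬ (steinbergWD F C b).IsEquivalent (steinbergWD F C 0) := fun ⟨e⟩ =>
  hb (((steinbergWD_N_eq_zero_iff F C b).1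
    ((show (steinbergWD F C 0).IsEquivalent (steinbergWD F C b) from ⟨e.symm⟩).N_eq_zero
      ((steinbergWD_N_eq_zero_iff F C 0).2 rfl))))

/-- **But in its closure**: for `b_m → 0` in a normed `C` the monodromy matrices of `St(b_m)`
converge to that of `St(0)` (the Weil-group action being constant): entrywise,
`St(b_m) → St(0)` — a sequence inside ONE isomorphism class with `N ≠ 0` converging to a
Weil–Deligne representation with `N = 0`.  (Gerstenhaber / Bellaïche–Chenevier Prop. 7.8.1:
`n` lies in the closure of the orbit of `n'` iff `t(n) ≺ t(n')`; here `n = 0`.)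
[cite: BellaicheChenevier2009, Prop. 7.8.1] -/
theorem tendsto_toMatrix'_steinbergWD_N {C : Type*} [NormedField C] [CharZero C] (b : ℕ → C)
    (hb : Tendsto b atTop (𝓝 0)) :
    Tendsto (fun m => LinearMap.toMatrix' (steinbergWD F C (b m)).N) atTop
      (𝓝 (LinearMap.toMatrix' (steinbergWD F C 0).N)) := by
  simp only [toMatrix'_steinbergWD_N]
  have h : Tendsto (fun m => b m • Matrix.single (0 : Fin 2) (1 : Fin 2) (1 : C)) atTop
      (𝓝 ((0 : C) • Matrix.single (0 : Fin 2) (1 : Fin 2) (1 : C))) := hb.smul_const _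
  simpa [Matrix.smul_single] using h

/-- **The limit is `≺_I`-below the orbit** (Varma's order, tree `WeilDeligneRep.PrecI`):
`St(0) ≺_I St(b)` for every `b` — same restriction to inertia, and `rk 0^k ≤ rk N^k`.  With
`not_isEquivalent_steinbergWD_zero` this is the STRICT drop of monodromy in the limit that the
relation `≺` of the local–global compatibility theorems for limit-constructed representations
records (Varma Thm. 2; A'Campo–Hevesi–Thorne–Whitmore Cor. 1.2.2 and Lemma 6.0.3).
[cite: VarmaFMS2024, Def. 8.3] -/
theorem steinbergWD_zero_precI (b : C) : (steinbergWD F C 0).PrecI (steinbergWD F C b) := by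
  refine ⟨⟨Representation.Equiv.refl _⟩, fun d θ _ _ k => ?_⟩
  have hiso : (steinbergWD F C 0).inertiaIsotypic θ = (steinbergWD F C b).inertiaIsotypic θ :=
    WeilDeligneRep.inertiaIsotypic_congr (fun _ _ => rfl) θ
  rcases Nat.eq_zero_or_pos k with rfl | hk
  · rw [pow_zero, pow_zero, hiso]
  · rw [(steinbergWD_N_eq_zero_iff F C 0).2 rfl, zero_pow hk.ne', Submodule.map_zero, finrank_bot]
    exact Nat.zero_le _

end OrbitClosure

/-! ## 4. Rank two: upper-triangular framed representations, their diagonal part, frame rescaling -/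

section RankTwo

variable {G : Type*} [Group G] [TopologicalSpace G]

variable {E : Type*} [CommRing E] [TopologicalSpace E]

/-- `ρ : G →ₜ* GL₂(E)` is **upper triangular** in its frame: the `(1,0)` entry of every `ρ(σ)`
vanishes, i.e. the line `E·e₀` is `G`-stable (`ρ` is an extension of the character `ρ₁₁` by the
character `ρ₀₀`). [folklore] -/
def IsUpperTriangular (ρ : FramedRep G E 2) : Prop :=
  ∀ σ : G, ((ρ σ : GL (Fin 2) E) : Matrix (Fin 2) (Fin 2) E) 1 0 = 0

namespace IsUpperTriangular

variable {ρ : FramedRep G E 2}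

/-- The diagonal entries of an upper-triangular representation are multiplicative. [folklore] -/
theorem apply_mul_diag (h : IsUpperTriangular ρ) (σ τ : G) (i : Fin 2) :
    ((ρ (σ * τ) : GL (Fin 2) E) : Matrix (Fin 2) (Fin 2) E) i i =
      ((ρ σ : GL (Fin 2) E) : Matrix (Fin 2) (Fin 2) E) i i *
        ((ρ τ : GL (Fin 2) E) : Matrix (Fin 2) (Fin 2) E) i i := by
  rw [map_mul, Units.val_mul, Matrix.mul_apply, Fin.sum_univ_two]
  fin_cases i
  · simp [h τ]
  · simp [h σ]

/-- The diagonal of `ρ(σ)` as an invertible diagonal matrix (inverse: the diagonal of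
`ρ(σ)⁻¹ = ρ(σ⁻¹)`). [folklore] -/
def diagGL (h : IsUpperTriangular ρ) (σ : G) : GL (Fin 2) E where
  val := Matrix.diagonal fun i => ((ρ σ : GL (Fin 2) E) : Matrix (Fin 2) (Fin 2) E) i i
  inv := Matrix.diagonal fun i => (((ρ σ)⁻¹ : GL (Fin 2) E) : Matrix (Fin 2) (Fin 2) E) i i
  val_inv := by
    rw [Matrix.diagonal_mul_diagonal, ← Matrix.diagonal_one]
    congr 1
    funext i
    rw [← map_inv, ← h.apply_mul_diag, mul_inv_cancel, map_one, Units.val_one, Matrix.one_apply_eq]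
  inv_val := by
    rw [Matrix.diagonal_mul_diagonal, ← Matrix.diagonal_one]
    congr 1
    funext i
    rw [← map_inv, ← h.apply_mul_diag, inv_mul_cancel, map_one, Units.val_one, Matrix.one_apply_eq]

/-- **The diagonal part `ρ^{diag} = ρ₀₀ ⊕ ρ₁₁`** of an upper-triangular `ρ : G →ₜ* GL₂(E)`: the
continuous homomorphism `σ ↦ diag(ρ(σ)₀₀, ρ(σ)₁₁)` — the direct sum of the two diagonal characters,
i.e. the SEMISIMPLIFICATION of `ρ` in the same frame when `E` is a field. [folklore] -/
def diagPart (h : IsUpperTriangular ρ) : FramedRep G E 2 where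
  toFun := h.diagGL
  map_one' := by
    refine Units.ext ?_
    change Matrix.diagonal _ = 1
    rw [← Matrix.diagonal_one]
    congr 1
    funext i
    rw [map_one, Units.val_one, Matrix.one_apply_eq]
  map_mul' σ τ := by
    refine Units.ext ?_
    change Matrix.diagonal _ = Matrix.diagonal _ * Matrix.diagonal _
    rw [Matrix.diagonal_mul_diagonal]
    congr 1
    funext i
    exact h.apply_mul_diag σ τ i
  continuous_toFun := by
    refine Units.continuous_iff.2 ⟨?_, ?_⟩
    · have hc : Continuous fun σ : G => ((ρ σ : GL (Fin 2) E) : Matrix (Fin 2) (Fin 2) E) :=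
        Units.continuous_val.comp (map_continuous ρ)
      exact (continuous_pi fun i => hc.matrix_elem i i).matrix_diagonal
    · have hc : Continuous fun σ : G => (((ρ σ)⁻¹ : GL (Fin 2) E) : Matrix (Fin 2) (Fin 2) E) :=
        Units.continuous_coe_inv.comp (map_continuous ρ)
      exact (continuous_pi fun i => hc.matrix_elem i i).matrix_diagonal

/-- Unfolding lemma: the matrix of `ρ^{diag}(σ)`. [folklore] -/
@[simp] theorem coe_diagPart_apply (h : IsUpperTriangular ρ) (σ : G) :
    ((h.diagPart σ : GL (Fin 2) E) : Matrix (Fin 2) (Fin 2) E) =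
      Matrix.diagonal fun i => ((ρ σ : GL (Fin 2) E) : Matrix (Fin 2) (Fin 2) E) i i := rfl

/-- **`ρ` and `ρ^{diag}` have the same traces** (hence the same pseudocharacter): the datum that
`p`-adic limit / congruence constructions control. [folklore] -/
theorem trace_diagPart (h : IsUpperTriangular ρ) (σ : G) : h.diagPart.trace σ = ρ.trace σ := by
  rw [FramedRep.trace, FramedRep.trace, coe_diagPart_apply, Matrix.trace_fin_two, Matrix.trace_fin_two,
    Matrix.diagonal_apply_eq, Matrix.diagonal_apply_eq]

/-- `ρ` and `ρ^{diag}` have the same determinants. [folklore] -/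
theorem det_diagPart (h : IsUpperTriangular ρ) (σ : G) :
    Matrix.det ((h.diagPart σ : GL (Fin 2) E) : Matrix (Fin 2) (Fin 2) E) =
      Matrix.det ((ρ σ : GL (Fin 2) E) : Matrix (Fin 2) (Fin 2) E) := by
  rw [coe_diagPart_apply, Matrix.det_diagonal, Matrix.det_fin_two, h σ, Fin.prod_univ_two]
  ring

/-- `ρ` and `ρ^{diag}` have the same characteristic polynomials. [folklore] -/
theorem charpoly_diagPart [Nontrivial E] (h : IsUpperTriangular ρ) (σ : G) :
    h.diagPart.charpoly σ = ρ.charpoly σ := by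
  rw [FramedRep.charpoly, FramedRep.charpoly, Matrix.charpoly_fin_two, Matrix.charpoly_fin_two,
    h.det_diagPart σ,
    show Matrix.trace ((h.diagPart σ : GL (Fin 2) E) : Matrix (Fin 2) (Fin 2) E) =
      Matrix.trace ((ρ σ : GL (Fin 2) E) : Matrix (Fin 2) (Fin 2) E) from h.trace_diagPart σ]

end IsUpperTriangular

variable [IsTopologicalRing E]

/-- Entries of the rescaled representation `d(c) ρ d(c)⁻¹`. [folklore] -/
theorem conj_scaleGL_apply (c : Eˣ) (ρ : FramedRep G E 2) (σ : G) (i j : Fin 2) :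
    ((FramedRep.conj (scaleGL c) ρ σ : GL (Fin 2) E) : Matrix (Fin 2) (Fin 2) E) i j =
      ![(1 : E), ((c⁻¹ : Eˣ) : E)] i * ((ρ σ : GL (Fin 2) E) : Matrix (Fin 2) (Fin 2) E) i j *
        ![(1 : E), (c : E)] j := by
  rw [FramedRep.conj_apply, Units.val_mul, Units.val_mul, coe_scaleGL, coe_scaleGL_inv,
    Matrix.mul_diagonal, Matrix.diagonal_mul]

/-- Entry formulas for `d(c) ρ d(c)⁻¹`: `(ρ₀₀, ρ₀₁ c; c⁻¹ ρ₁₀, ρ₁₁)`. [folklore] -/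
theorem conj_scaleGL_entries (c : Eˣ) (ρ : FramedRep G E 2) (σ : G) :
    ((FramedRep.conj (scaleGL c) ρ σ : GL (Fin 2) E) : Matrix (Fin 2) (Fin 2) E) 0 0 =
        ((ρ σ : GL (Fin 2) E) : Matrix (Fin 2) (Fin 2) E) 0 0 ∧
      ((FramedRep.conj (scaleGL c) ρ σ : GL (Fin 2) E) : Matrix (Fin 2) (Fin 2) E) 0 1 =
        ((ρ σ : GL (Fin 2) E) : Matrix (Fin 2) (Fin 2) E) 0 1 * c ∧
      ((FramedRep.conj (scaleGL c) ρ σ : GL (Fin 2) E) : Matrix (Fin 2) (Fin 2) E) 1 0 =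
        ((c⁻¹ : Eˣ) : E) * ((ρ σ : GL (Fin 2) E) : Matrix (Fin 2) (Fin 2) E) 1 0 ∧
      ((FramedRep.conj (scaleGL c) ρ σ : GL (Fin 2) E) : Matrix (Fin 2) (Fin 2) E) 1 1 =
        ((ρ σ : GL (Fin 2) E) : Matrix (Fin 2) (Fin 2) E) 1 1 := by
  refine ⟨?_, ?_, ?_, ?_⟩ <;> rw [conj_scaleGL_apply] <;>
    simp only [Matrix.cons_val_zero, Matrix.cons_val_one, one_mul, mul_one]
  rw [mul_right_comm, Units.inv_mul, one_mul]

/-- Rescaling the frame preserves upper-triangularity. [folklore] -/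
theorem IsUpperTriangular.conj_scaleGL {ρ : FramedRep G E 2} (h : IsUpperTriangular ρ) (c : Eˣ) :
    IsUpperTriangular (FramedRep.conj (scaleGL c) ρ) := fun σ => by
  rw [(conj_scaleGL_entries c ρ σ).2.2.1, h σ, mul_zero]

/-- A change of frame does not change traces. [folklore] -/
theorem trace_conj (g : GL (Fin 2) E) (ρ : FramedRep G E 2) (σ : G) :
    (FramedRep.conj g ρ).trace σ = ρ.trace σ := by
  rw [FramedRep.trace, FramedRep.trace, FramedRep.conj_apply, Units.val_mul, Units.val_mul,
    Matrix.trace_units_conj]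

end RankTwo

/-! ## 5. Framewise uniform convergence `d(c_m) ρ d(c_m)⁻¹ → ρ^{diag}` as `c_m → 0` -/

section Normed

variable {G : Type*} [Group G] [TopologicalSpace G]
variable {E : Type*} [NormedField E]

/-- **Uniform convergence in a fixed frame**: `ρ_m → ρ_∞` uniformly on `G`, entry by entry of the
matrices `ρ_m(σ) ∈ GL_n(E)` — the sense in which a Galois representation "is a `p`-adic limit" of
representations `ρ_m` (e.g. `ρ ≡ ρ_m mod ℓ^m` in a fixed lattice basis). [folklore] -/
def TendstoUniformlyInFrame {n : ℕ} (ρs : ℕ → FramedRep G E n) (ρlim : FramedRep G E n) : Prop :=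
  ∀ ε > (0 : ℝ), ∀ᶠ m in atTop, ∀ (σ : G) (i j : Fin n),
    ‖((ρs m σ : GL (Fin n) E) : Matrix (Fin n) (Fin n) E) i j -
        ((ρlim σ : GL (Fin n) E) : Matrix (Fin n) (Fin n) E) i j‖ < ε

/-- Entrywise distance from `d(c) ρ d(c)⁻¹` to `ρ^{diag}`: only the `(0,1)` entry `c · ρ₀₁`
survives. [folklore] -/
theorem IsUpperTriangular.norm_conj_scaleGL_sub_diagPart_le {ρ : FramedRep G E 2}
    (h : IsUpperTriangular ρ) (c : Eˣ) (σ : G) (i j : Fin 2) :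
    ‖((FramedRep.conj (scaleGL c) ρ σ : GL (Fin 2) E) : Matrix (Fin 2) (Fin 2) E) i j -
        ((h.diagPart σ : GL (Fin 2) E) : Matrix (Fin 2) (Fin 2) E) i j‖ ≤
      ‖(c : E)‖ * ‖((ρ σ : GL (Fin 2) E) : Matrix (Fin 2) (Fin 2) E) 0 1‖ := by
  obtain ⟨h00, h01, h10, h11⟩ := conj_scaleGL_entries c ρ σ
  have hnn : 0 ≤ ‖(c : E)‖ * ‖((ρ σ : GL (Fin 2) E) : Matrix (Fin 2) (Fin 2) E) 0 1‖ := by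
    positivity
  rw [h.coe_diagPart_apply]
  revert i j
  simp only [Fin.forall_fin_two]
  refine ⟨⟨?_, ?_⟩, ?_, ?_⟩
  · rw [h00, Matrix.diagonal_apply_eq, sub_self, norm_zero]
    exact hnn
  · rw [h01, Matrix.diagonal_apply_ne _ (by decide), sub_zero, norm_mul, mul_comm]
  · rw [h10, h σ, mul_zero, Matrix.diagonal_apply_ne _ (by decide), sub_zero, norm_zero]
    exact hnn
  · rw [h11, Matrix.diagonal_apply_eq, sub_self, norm_zero]
    exact hnn

/-- **The rescaled conjugates converge to the diagonal part, uniformly on a compact group.**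
For `G` compact (e.g. an absolute Galois group), `ρ : G →ₜ* GL₂(E)` upper triangular and units
`c_m → 0` in `E`, the representations `ρ_m = d(c_m) ρ d(c_m)⁻¹ = (ρ₀₀, c_m ρ₀₁; 0, ρ₁₁)` — all
CONJUGATE to `ρ` — converge uniformly on `G`, in the fixed frame, to `ρ^{diag} = ρ₀₀ ⊕ ρ₁₁`:
the orbit of a non-semisimple representation is not closed and its closure contains the
semisimplification. [folklore] -/
theorem IsUpperTriangular.tendstoUniformlyInFrame_conj_scaleGL [CompactSpace G]
    {ρ : FramedRep G E 2} (h : IsUpperTriangular ρ) (c : ℕ → Eˣ)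
    (hc : Tendsto (fun m => (c m : E)) atTop (𝓝 0)) :
    TendstoUniformlyInFrame (fun m => FramedRep.conj (scaleGL (c m)) ρ) h.diagPart := by
  obtain ⟨B, hB⟩ : ∃ B : ℝ, ∀ σ : G, ‖((ρ σ : GL (Fin 2) E) : Matrix (Fin 2) (Fin 2) E) 0 1‖ ≤ B := by
    have hcont : Continuous fun σ : G => ((ρ σ : GL (Fin 2) E) : Matrix (Fin 2) (Fin 2) E) 0 1 :=
      (Units.continuous_val.comp (map_continuous ρ)).matrix_elem 0 1
    obtain ⟨B, hB⟩ := isCompact_univ.exists_bound_of_continuousOn hcont.continuousOn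
    exact ⟨B, fun σ => hB σ (Set.mem_univ σ)⟩
  intro ε hε
  have hB1 : 0 < B + 1 := by
    have := (norm_nonneg _).trans (hB 1)
    linarith
  have hev : ∀ᶠ m in atTop, ‖(c m : E)‖ < ε / (B + 1) :=
    NormedAddGroup.tendsto_nhds_zero.1 hc _ (div_pos hε hB1)
  filter_upwards [hev] with m hm σ i j
  calc ‖((FramedRep.conj (scaleGL (c m)) ρ σ : GL (Fin 2) E) : Matrix (Fin 2) (Fin 2) E) i j -
          ((h.diagPart σ : GL (Fin 2) E) : Matrix (Fin 2) (Fin 2) E) i j‖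
        ≤ ‖(c m : E)‖ * ‖((ρ σ : GL (Fin 2) E) : Matrix (Fin 2) (Fin 2) E) 0 1‖ :=
          h.norm_conj_scaleGL_sub_diagPart_le (c m) σ i j
    _ ≤ ‖(c m : E)‖ * (B + 1) :=
          mul_le_mul_of_nonneg_left ((hB σ).trans (by linarith)) (norm_nonneg _)
    _ < ε / (B + 1) * (B + 1) := mul_lt_mul_of_pos_right hm hB1
    _ = ε := div_mul_cancel₀ ε hB1.ne'

end Normed

/-! ## 6. The `ℓ`-adic side: the recipe along the sequence and at the limit -/

section Ladic

variable {F : Type*} [Field F] [ValuativeRel F] [TopologicalSpace F] [IsNonarchimedeanLocalField F]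
variable {E : Type*} [NormedField E] [CharZero E]

open Field

omit [CharZero E] in
/-- A nilpotent `2 × 2` matrix over a field squares to zero (Cayley–Hamilton: its characteristic
polynomial is `X²`). [folklore] -/
theorem sq_eq_zero_of_isNilpotent {A : Matrix (Fin 2) (Fin 2) E} (hA : IsNilpotent A) : A ^ 2 = 0 := by
  have h1 : A.charpoly = Polynomial.X ^ 2 := by
    have h := (Matrix.isNilpotent_charpoly_sub_pow_of_isNilpotent hA).eq_zero
    rw [sub_eq_zero] at h
    simpa using h
  have h2 := Matrix.aeval_self_charpoly A
  rwa [h1, map_pow, Polynomial.aeval_X] at h2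

/-- For a `2 × 2` nilpotent `N` and a scalar `s`, `exp(s N) = 1 + s N`. [folklore] -/
theorem exp_smul_eq_one_add {N : Matrix (Fin 2) (Fin 2) E} (hN : IsNilpotent N) (s : E) :
    IsNilpotent.exp (s • N) = 1 + s • N := by
  have h0 : (s • N) ^ 2 = 0 := by rw [smul_pow, sq_eq_zero_of_isNilpotent hN, smul_zero]
  rw [IsNilpotent.exp_eq_sum h0]
  simp [Finset.sum_range_succ]

variable {ρ : FramedRep (absoluteGaloisGroup F) E 2} {r : WeilDeligneRep F E (Fin 2 → E)}

/-- **Shape of the monodromy of an upper-triangular Steinberg-attached `ρ`.**  If `ρ` is upper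
triangular and `(ρ_WD, N)` is attached to `ρ|_{W_F}` with `ρ(u) = exp(t(u) N)` on `U` and `t`
non-trivial at some `u₀ ∈ U`, then the matrix of `N` is strictly upper triangular: `N₁₀ = 0`
(compare the `(1,0)` entries of `ρ(u₀) = 1 + t(u₀) N`), hence `N₀₀ = N₁₁ = 0` (`N² = 0`).
[folklore] -/
theorem toMatrix'_N_entries (h : IsUpperTriangular ρ)
    {t : WeilGroup.inertia F →* Multiplicative E} {U : Subgroup (WeilGroup F)}
    (ht : ∃ u : WeilGroup.inertia F, (u : WeilGroup F) ∈ U ∧ t u ≠ 1)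
    (h1 : ∀ u : WeilGroup.inertia F, (u : WeilGroup F) ∈ U →
      ((ρ.toWeilGroupHom u : GL (Fin 2) E) : Matrix (Fin 2) (Fin 2) E) =
        IsNilpotent.exp ((t u).toAdd • LinearMap.toMatrix' r.N)) :
    LinearMap.toMatrix' r.N 1 0 = 0 ∧ LinearMap.toMatrix' r.N 0 0 = 0 ∧
      LinearMap.toMatrix' r.N 1 1 = 0 := by
  set Nm := LinearMap.toMatrix' r.N with hNm
  have hnil : IsNilpotent Nm := isNilpotent_toMatrix'_N r
  have hsq : Nm ^ 2 = 0 := sq_eq_zero_of_isNilpotent hnil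
  obtain ⟨u₀, hu₀, ht0⟩ := ht
  have hs : (t u₀).toAdd ≠ 0 := fun h0 => ht0 (by rw [← ofAdd_toAdd (t u₀), h0, ofAdd_zero])
  have h10 : Nm 1 0 = 0 := by
    have e := congr_fun (congr_fun (h1 u₀ hu₀) 1) 0
    rw [exp_smul_eq_one_add hnil, FramedRep.toWeilGroupHom_apply] at e
    rw [h (WeilGroup.toAbsGalois F u₀)] at e
    simp only [Matrix.add_apply, Matrix.one_apply_ne (by decide : (1 : Fin 2) ≠ 0),
      Matrix.smul_apply, smul_eq_mul, zero_add] at e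
    exact (mul_eq_zero.1 e.symm).resolve_left hs
  have hsq' := fun i j => congr_fun (congr_fun hsq i) j
  have h00 : Nm 0 0 = 0 := by
    have e := hsq' 0 0
    simp only [pow_two, Matrix.mul_apply, Fin.sum_univ_two, h10, Matrix.zero_apply, mul_zero,
      add_zero] at e
    exact pow_eq_zero_iff (n := 2) (by norm_num) |>.1 (by rw [pow_two]; exact e)
  have h11 : Nm 1 1 = 0 := by
    have e := hsq' 1 1
    simp only [pow_two, Matrix.mul_apply, Fin.sum_univ_two, h10, Matrix.zero_apply, zero_mul,
      zero_add] at e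
    exact pow_eq_zero_iff (n := 2) (by norm_num) |>.1 (by rw [pow_two]; exact e)
  exact ⟨h10, h00, h11⟩

/-- **On `U` the representation is unipotent with trivial diagonal**, so the diagonal part
`ρ^{diag}` is TRIVIAL on `U`: `ρ^{diag}` has finite inertia image on `W_F`. [folklore] -/
theorem diagPart_toWeilGroupHom_eq_one (h : IsUpperTriangular ρ)
    {t : WeilGroup.inertia F →* Multiplicative E} {U : Subgroup (WeilGroup F)}
    (hU : U ≤ WeilGroup.inertia F)
    (ht : ∃ u : WeilGroup.inertia F, (u : WeilGroup F) ∈ U ∧ t u ≠ 1)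
    (h1 : ∀ u : WeilGroup.inertia F, (u : WeilGroup F) ∈ U →
      ((ρ.toWeilGroupHom u : GL (Fin 2) E) : Matrix (Fin 2) (Fin 2) E) =
        IsNilpotent.exp ((t u).toAdd • LinearMap.toMatrix' r.N)) :
    ∀ u ∈ U, h.diagPart.toWeilGroupHom u = 1 := by
  obtain ⟨h10, h00, h11⟩ := toMatrix'_N_entries h ht h1
  intro u hu
  have e := h1 ⟨u, hU hu⟩ hu
  rw [exp_smul_eq_one_add (isNilpotent_toMatrix'_N r)] at e
  refine Units.ext ?_
  rw [FramedRep.toWeilGroupHom_apply, h.coe_diagPart_apply, Units.val_one, ← Matrix.diagonal_one]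
  congr 1
  funext i
  have ei := congr_fun (congr_fun e i) i
  rw [FramedRep.toWeilGroupHom_apply] at ei
  change ((ρ (WeilGroup.toAbsGalois F u) : GL (Fin 2) E) : Matrix (Fin 2) (Fin 2) E) i i = 1
  rw [ei]
  fin_cases i
  · simp [h00]
  · simp [h11]

/-- **Main construction (the barrier, universe-polymorphic form).**  Let `ρ : Γ_F →ₜ* GL₂(E)` be
upper triangular with a Weil–Deligne representation `r = (ρ_WD, N)`, `N ≠ 0`, attached to
`ρ|_{W_F}` by the Grothendieck–Deligne recipe, and let `c_m → 0` be units of `E`.  Then: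
(i) every `ρ_m := d(c_m) ρ d(c_m)⁻¹` is conjugate to `ρ`, has the (isomorphic) transported
Weil–Deligne representation `d(c_m) r d(c_m)⁻¹` attached, with `N ≠ 0`, and the same traces as
`ρ^{diag}`; (ii) `ρ_m → ρ^{diag}` uniformly on `Γ_F` in the frame; (iii) `ρ^{diag}` has a
Weil–Deligne representation with `N = 0` attached by the same recipe, and (iv) EVERY Weil–Deligne
representation attached to `ρ^{diag}` has `N = 0`. [folklore] -/
theorem monodromy_not_closed (h : IsUpperTriangular ρ) (hr : IsWeilDeligneOfLadic ρ.toWeilGroupHom r)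
    (hN : r.N ≠ 0) (c : ℕ → Eˣ) (hc : Tendsto (fun m => (c m : E)) atTop (𝓝 0)) :
    (∀ m : ℕ,
        IsWeilDeligneOfLadic (FramedRep.conj (scaleGL (c m)) ρ).toWeilGroupHom
            (r.glConj (scaleGL (c m))) ∧
          (r.glConj (scaleGL (c m))).N ≠ 0 ∧ (r.glConj (scaleGL (c m))).IsEquivalent r ∧
          ∀ σ, (FramedRep.conj (scaleGL (c m)) ρ).trace σ = h.diagPart.trace σ) ∧
      TendstoUniformlyInFrame (fun m => FramedRep.conj (scaleGL (c m)) ρ) h.diagPart ∧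
      (∃ r₀ : WeilDeligneRep F E (Fin 2 → E),
        IsWeilDeligneOfLadic h.diagPart.toWeilGroupHom r₀ ∧ r₀.N = 0) ∧
      ∀ r' : WeilDeligneRep F E (Fin 2 → E),
        IsWeilDeligneOfLadic h.diagPart.toWeilGroupHom r' → r'.N = 0 := by
  haveI : CompactSpace (absoluteGaloisGroup F) := absoluteGaloisGroup_compactSpace F
  obtain ⟨t, U, Φ, hU, hUo, hΦ, ht, h1, h2⟩ := hr
  have hker := diagPart_toWeilGroupHom_eq_one h hU ht h1
  obtain ⟨h0, hall⟩ :=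
    N_eq_zero_of_isWeilDeligneOfLadic_of_ker h.diagPart.toWeilGroupHom t U hU hUo ht hker Φ hΦ
  refine ⟨fun m => ⟨?_, ?_, transport_isEquivalent r _, fun σ => ?_⟩,
    h.tendstoUniformlyInFrame_conj_scaleGL c hc, ⟨_, h0, rfl⟩, hall⟩
  · have e : (FramedRep.conj (scaleGL (c m)) ρ).toWeilGroupHom =
        (MulAut.conj (scaleGL (c m))).toMonoidHom.comp ρ.toWeilGroupHom :=
      MonoidHom.ext fun _ => rfl
    rw [e]
    exact IsWeilDeligneOfLadic.glConj ⟨t, U, Φ, hU, hUo, hΦ, ht, h1, h2⟩ _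
  · rwa [Ne, WeilDeligneRep.glConj, transport_N_eq_zero_iff]
  · rw [trace_conj, h.trace_diagPart]

end Ladic

/-! ## 7. The technique class and the barrier -/

section Statements

open Field

/-- **TECHNIQUE CLASS (D-0021): "`ℓ`-adic limits preserve the monodromy operator".**  For a
non-archimedean local field `F` and a normed coefficient field `E` of characteristic `0`
(intended: `E = ℚ̄_ℓ`, `ℓ ≠ p`), the LEMMA that every argument in the class needs at the place
`F`: whenever `ρ : Γ_F →ₜ* GL₂(E)` has an attached Weil–Deligne representation with `N ≠ 0`
(Grothendieck–Deligne recipe `IsWeilDeligneOfLadic`, the relation of `LocalGlobalCompatibleAt`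
at `v ∤ ℓ`), and CONJUGATES `g_m ρ g_m⁻¹` of `ρ` (so: the same isomorphism class — same inertial
type, same traces, same everything) converge uniformly on `Γ_F` in the frame to `ρ_∞`, every
Weil–Deligne representation attached to `ρ_∞` still has `N ≠ 0`.  This is the weakest form of
"the limit of representations with monodromy of shape `ν` has monodromy of shape `ν`"; it is
REFUTED below (`not_ladicLimitsPreserveMonodromy`). [folklore] -/
def LadicLimitsPreserveMonodromy (F : Type*) [Field F] [ValuativeRel F] [TopologicalSpace F]
    [IsNonarchimedeanLocalField F] (E : Type*) [NormedField E] [CharZero E] : Prop :=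
  ∀ (ρ : FramedRep (absoluteGaloisGroup F) E 2) (g : ℕ → GL (Fin 2) E)
    (ρlim : FramedRep (absoluteGaloisGroup F) E 2) (r rlim : WeilDeligneRep F E (Fin 2 → E)),
    IsWeilDeligneOfLadic ρ.toWeilGroupHom r → r.N ≠ 0 →
    TendstoUniformlyInFrame (fun m => FramedRep.conj (g m) ρ) ρlim →
    IsWeilDeligneOfLadic ρlim.toWeilGroupHom rlim → rlim.N ≠ 0

/-- **BARRIER: the monodromy operator is not closed under `p`-adic limits** (statement; PROVED
as `MonodromyNotClosedUnderPadicLimits_holds` — a theorem, not a named fact).  For every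
non-archimedean local field `F`, every normed field `E` of characteristic `0` (e.g. `E = ℚ̄_ℓ`,
the coefficients of `LocalGlobalCompatibleAt`), every upper-triangular continuous
`ρ : Γ_F →ₜ* GL₂(E)` with a Weil–Deligne representation `r = (ρ_WD, N)`, `N ≠ 0`, attached to
`ρ|_{W_F}` by the Grothendieck–Deligne recipe (`IsWeilDeligneOfLadic`; witnesses: `ℓ`-adic Tate
modules of Tate curves, `ℓ ≠ p` [cite: SilvermanATAEC1994, Thm. V.3.1 and Prop. V.6.1]), and
every sequence of units `c_m → 0` of `E`: the representations `ρ_m := d(c_m) ρ d(c_m)⁻¹`,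
`d(c) = diag(1, c⁻¹)`, (i) are each attached to the transported Weil–Deligne representation
`d(c_m) r d(c_m)⁻¹`, which is ISOMORPHIC to `r` and has `N ≠ 0`, and have the same traces as
`ρ^{diag} = ρ₀₀ ⊕ ρ₁₁`; (ii) converge to `ρ^{diag}` uniformly on `Γ_F`, entrywise in the frame;
(iii) `ρ^{diag}` has an attached Weil–Deligne representation with `N = 0`, and (iv) EVERY
Weil–Deligne representation attached to `ρ^{diag}` has `N = 0`.  So `{ρ' : N(ρ') ≠ 0}` — indeed a
single isomorphism class inside it — has a limit point all of whose Weil–Deligne representations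
have `N = 0`: "`N ≠ 0`" / "`N` of type `ν`" is not a closed condition, and a representation known
only as a limit of representations of monodromy type `ν` (with constant traces, inertial type and
Hodge type) is only known to satisfy `N ≺ ν` — the relation of Varma's Thm. 2 and of
A'Campo–Hevesi–Thorne–Whitmore's Cor. 1.2.2 / Lemma 6.0.3 ("Suppose that `N` lies in the
closure of the `G(r)`-orbit of `N′`. Then `(r, N) ≺ (r, N′)`"), whose `n = 2`, `N = 0` instance is
`steinbergWD_zero_precI` + `tendsto_toMatrix'_steinbergWD_N`. [cite: AHTW2026, Cor. 1.2.2 and Lemma 6.0.3]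

BARRIER (structured block, D-0021):
- technique_class: p-adic-limit congruence pseudorepresentation l-adic-interpolation bounded-type-approximation torsion-classes eigenvariety-specialisation — every argument whose only input at the finite place `v` is "`r|_{Γ_{F_v}}` is a `p`-adic (resp. `ℓ`-adic) limit, uniformly in a frame (a fortiori: in trace / pseudocharacter), of representations `ρ_m|_{Γ_{F_v}}` whose Weil–Deligne representations have monodromy of a fixed Jordan type `ν ≠ 0` and bounded (even constant) inertial type, conductor and Hodge–Tate type"; typed as the lemma `LadicLimitsPreserveMonodromy F E` such an argument needs, refuted by `not_ladicLimitsPreserveMonodromy`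
- blocks: concluding the `N`-part of `Summit.Langlands.LocalGlobalCompatibleAt` (Taylor Conj. 7 with its monodromy operator) for the limit-constructed `r_{p,ı}(π)`, `π` regular algebraic cuspidal NON-polarizable over a CM field [cite: HarrisLanTaylorThorneRMS2016, Thm. A] [cite: Scholze2015, Introduction, Thm. 4 and Thm. 5], by the approximation itself: what it yields is `WD^{ss}`-compatibility [cite: VarmaFMS2024, Thm. 2 and Def. 8.3] (`v ∤ p`, with `≺`), [cite: AHTW2026, Cor. 1.2.2 and Lemma 6.0.3] (`v ∣ p`: Thm. 1.2.1 semisimplified, Cor. 1.2.2 `≺`), and "it doesn't seem possible to understand the monodromy operator in this way" [cite: AllenNewton2020, §1 and Thm. 1.1]; the same wall meets any route deciding `N` at a Steinberg / special place of a torsion-built representation from limit data alone (e.g. the `N`-equality cruxes of the retired Langlands routes WeightVelocityMonodromy / SteinbergWeightVelocity, and the `v ∣ p` residue of EisensteinGelfandKirillov.SectorComplement)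
- because: along `ρ_m = d(c_m) ρ d(c_m)⁻¹ → ρ^{diag}` every isomorphism invariant and every trace is CONSTANT and `N(ρ_m) ≠ 0`, yet every Weil–Deligne representation attached to the limit has `N = 0` (`monodromy_not_closed`, proved here: the recipe makes `ρ = 1 + t(u)N` unipotent with trivial diagonal on the open `U ≤ I_F`, so `ρ^{diag}` has finite inertia image and `(ρ^{diag}, 0)` is attached, uniquely up to isomorphism [cite: DeligneAntwerpII1973, §8.4.2]); abstractly: a nilpotent `n` lies in the closure of the conjugacy class of `n′` iff `t(n) ≺ t(n′)` [cite: BellaicheChenevier2009, Prop. 7.8.1 and Prop. 7.8.20] (Gerstenhaber; and Prop. 7.8.20 (iii): in `p`-adic families at `l ≠ p` only `N̄_x ≺_{I_F} N^{gen}` holds), so `0` lies in the closure of EVERY orbit and the monodromy type is upper semicontinuous, never continuous, under specialisation / limits; Taylor's theorem reconstructs from the limit pseudocharacter only a SEMISIMPLE representation [cite: VarmaFMS2024, Thm. 2 and Def. 8.3] ("a continuous semisimple Galois representation … whose trace is equal to `T`"), and `tr ρ = tr ρ^{diag}` (`trace_diagPart`)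
- evasions_known: (i) GEOMETRY instead of limits: find `r` (or `r^{⊗2}`) in the cohomology of a variety with semistable reduction and read `N` off the weight–monodromy / Rapoport–Zink spectral sequence — the polarizable (conjugate self-dual) case, complete by [cite: Caraiani2014, Thm. 1.1] (and Caraiani 2012 for `l ≠ p`, Taylor–Yoshida), unavailable for non-polarizable `π` ("in the non-polarizable case the representation `r_{p,ı}(π)` will never occur in the Betti or étale cohomology of a Shimura variety" [cite: HarrisLanTaylorThorneRMS2016, Thm. A], p. 3); (ii) AUTOMORPHY LIFTING instead of limits: if `N = 0` at a place where `π` is special, an automorphy lifting theorem with `v` removed from the ramification set plus strong multiplicity one gives a contradiction (Luu; Allen–Newton for `GL₂`, weight `0`, CM `F`, density-one set of `l`, after a potential-automorphy step producing the needed congruence) [cite: AllenNewton2020, §1 and Thm. 1.1], and Yang (arXiv:2407.00288) at `l = p` in a rank-two case [cite: YangLGC2024, Thm. 1.1]; (iii) a `p`-adic MAZUR PRINCIPLE / level-lowering argument on the eigenvariety (Newton, Hilbert partial weight one; cited in [cite: AllenNewton2020, §1 and Thm. 1.1]); (iv) use MORE than the limit: the generic-orbit argument gives the opposite inequality for free when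 `rec(π_v)` is generic and one knows `N_Gal` is generic too [cite: AHTW2026, Cor. 1.2.2 and Lemma 6.0.3] (Prop. 6.0.5) — i.e. supply an independent LOWER bound on `rk N` (non-split extension classes, `𝓛`-invariants, companion points), which is exactly what the approximation does not carry
- scope_caveats: (a) PROVED here only on the `ℓ ≠ p` side of the dictionary (Grothendieck–Deligne recipe `IsWeilDeligneOfLadic`, any normed `E` of characteristic `0`, any `F`); the `v ∣ p` twin — Kummer classes `κ(p^{p^m}u) = p^m κ(p) + κ(u) → κ(u) ∈ H¹_f`, semistable non-crystalline extensions of `ℚ_p` by `ℚ_p(1)` (Tate curves `E_{q_m}`, `N ≠ 0`, Hodge–Tate weights `{0,1}`, trivial inertial type) converging to a crystalline one (`N = 0`) [cite: BlochKato1990, Example 3.9] (with the remark after (3.7.4)) — is the same mechanism but is NOT stated in Lean, because the summit's datum `ReciprocityData.pst` (`PstWeilDeligneData`) is pinned by specification and the tree cannot yet compute `WD ∘ D_pst` of a given representation; (b) the hypothesis "an upper-triangular Steinberg-attached `ρ : Γ_F →ₜ* GL₂(E)` exists" is witnessed in print (Tate curves [cite: SilvermanATAEC1994, Thm. V.3.1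 and Prop. V.6.1]; the `ℓ`-adic tame character) but not constructed in the tree (the tree's `GrothendieckDeligne_exists_isWeilDeligneOfLadic` is a named fact and constructs no `ρ`); the Weil–Deligne-level statements of §3 (`steinbergWD_…`) are unconditional; (c) the barrier says NOTHING against the truth of `N`-equality in `LocalGlobalCompatibleAt`, nor against limit arguments that carry extra structure through the limit (a family with a generic fibre and `≺` in the other direction, an Euler-system / `𝓛`-invariant input, finiteness of a Selmer group): it only shows that frame-wise (hence trace-wise) convergence with constant types does not determine `N`; (d) rank `2` and the Steinberg type `ν = (2)` only are formalised; for general `n` and `ν` the closure statement is Gerstenhaber's theorem [cite: BellaicheChenevier2009, Prop. 7.8.1 and Prop. 7.8.20], not vendored here; (e) "uniform convergence in a frame" (`TendstoUniformlyInFrame`) is the strong, entrywise notion; convergence of traces / pseudocharacters (what HLTT–Scholze–Varma literally use) is weaker, so the barrier applies to it a fortiori (`trace_conj`, `trace_diagPart`: the traces are even constant)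
- status: established [cite: AllenNewton2020, §1 and Thm. 1.1] [cite: BellaicheChenevier2009, Prop. 7.8.1 and Prop. 7.8.20] [cite: AHTW2026, Cor. 1.2.2 and Lemma 6.0.3] -/
def MonodromyNotClosedUnderPadicLimits : Prop :=
  ∀ (F : Type) [Field F] [ValuativeRel F] [TopologicalSpace F] [IsNonarchimedeanLocalField F]
    (E : Type) [NormedField E] [CharZero E]
    (ρ : FramedRep (absoluteGaloisGroup F) E 2) (hρ : IsUpperTriangular ρ)
    (r : WeilDeligneRep F E (Fin 2 → E)), IsWeilDeligneOfLadic ρ.toWeilGroupHom r → r.N ≠ 0 →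
    ∀ c : ℕ → Eˣ, Tendsto (fun m => (c m : E)) atTop (𝓝 0) →
      (∀ m : ℕ,
          IsWeilDeligneOfLadic (FramedRep.conj (scaleGL (c m)) ρ).toWeilGroupHom
              (r.glConj (scaleGL (c m))) ∧
            (r.glConj (scaleGL (c m))).N ≠ 0 ∧ (r.glConj (scaleGL (c m))).IsEquivalent r ∧
            ∀ σ, (FramedRep.conj (scaleGL (c m)) ρ).trace σ = hρ.diagPart.trace σ) ∧
        TendstoUniformlyInFrame (fun m => FramedRep.conj (scaleGL (c m)) ρ) hρ.diagPart ∧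
        (∃ r₀ : WeilDeligneRep F E (Fin 2 → E),
          IsWeilDeligneOfLadic hρ.diagPart.toWeilGroupHom r₀ ∧ r₀.N = 0) ∧
        ∀ r' : WeilDeligneRep F E (Fin 2 → E),
          IsWeilDeligneOfLadic hρ.diagPart.toWeilGroupHom r' → r'.N = 0

/-- **The barrier holds** (discharge of `MonodromyNotClosedUnderPadicLimits`). [folklore] -/
theorem MonodromyNotClosedUnderPadicLimits_holds : MonodromyNotClosedUnderPadicLimits :=
  fun _F _ _ _ _ _E _ _ _ρ hρ _r hr hN c hc => monodromy_not_closed hρ hr hN c hc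

variable {F : Type*} [Field F] [ValuativeRel F] [TopologicalSpace F] [IsNonarchimedeanLocalField F]
variable {E : Type*} [NontriviallyNormedField E] [CharZero E]

/-- **The typed no-go.**  As soon as ONE upper-triangular `ρ : Γ_F →ₜ* GL₂(E)` with an attached
Weil–Deligne representation of non-zero monodromy exists (e.g. the `ℓ`-adic Tate module of a
Tate curve, `v ∤ ℓ`), the technique-class lemma `LadicLimitsPreserveMonodromy F E` is FALSE: with
`c_m = x^m`, `0 < ‖x‖ < 1`, the conjugates `d(c_m) ρ d(c_m)⁻¹` converge to `ρ^{diag}`, all of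
whose attached Weil–Deligne representations have `N = 0`. [folklore] -/
theorem not_ladicLimitsPreserveMonodromy
    (hex : ∃ (ρ : FramedRep (absoluteGaloisGroup F) E 2) (r : WeilDeligneRep F E (Fin 2 → E)),
      IsUpperTriangular ρ ∧ IsWeilDeligneOfLadic ρ.toWeilGroupHom r ∧ r.N ≠ 0) :
    ¬ LadicLimitsPreserveMonodromy F E := by
  obtain ⟨ρ, r, hρ, hr, hN⟩ := hex
  obtain ⟨x, hx0, hx1⟩ := NormedField.exists_norm_lt_one E
  have hx : x ≠ 0 := norm_pos_iff.1 hx0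
  set c : ℕ → Eˣ := fun m => Units.mk0 (x ^ m) (pow_ne_zero m hx) with hc
  have hc0 : Tendsto (fun m => (c m : E)) atTop (𝓝 0) := by
    simpa [hc] using tendsto_pow_atTop_nhds_zero_of_norm_lt_one hx1
  obtain ⟨-, hlim, ⟨r₀, hr₀, hr₀N⟩, -⟩ := monodromy_not_closed hρ hr hN c hc0
  intro H
  exact H ρ (fun m => scaleGL (c m)) hρ.diagPart r r₀ hr hN hlim hr₀ hr₀N

end Statements

end Literature.Barriers.Langlands
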